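/-
Copyright (c) 2026 the pub-hodgecm-mathlib formalisation cell (harness21).  Prover seat hodgecm-mathlib-F0P3b-p01 (g17): line LH3 (closer stub `stub_N9`), LETTER L1 clause (I₁),
brick (X-core) «CROSS CORNER × A REAL WALL AT A SPLIT PLACE» (LH3-plan (g4) DEAL 2026-09-02T12:00:29Z), layer L2^E «FINSET `E` HELD OUT», part 1 (the `chartOrbG` half).
-/
import Literature.NumberTheory.Rogawski1990.ArchChartOrbGHeldOut   -- ★ p851278 (this seat): §0 generic `measurePreserving_prodLeftComm` ∕ `integral_prod_prodLeftComm` ∕ `integrable_prodLeftComm_iff`; brings ★ (A1) p850949, ★ (A4) `forall_mem_pi_chartTorusGLoc_comm`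
import HarnessLib

/-!
# `chartOrbG` WITH A FINSET `E` OF COMPACT PLACES HELD OUT AS ONE QUOTIENT («`{w ∉ S′} = (E ∖ S′) ⊔ rest`»; Folland 1995 §2.6 (2.52); Rogawski 1990 §8.2–8.3)

Topic `NumberTheory/Rogawski1990`; namespace `Literature.NumberTheory.Automorphic.UnitaryGroup`.  THEOREMS ONLY (no `def`, no `instance`, no notation, no axiom, no named fact,
no `sorry`); kernel lane `--kind proof --supports stmt-HodgeConjecture-24833`.  Cell `pub/hodgecm-mathlib`, crux H413 (`stmt-HodgeConjecture-24833`), F0∕P3c line LH3 (closer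
stub `stub_N9`), LETTER L1 `HcOrbitalFamiliesStatement`, clause (I₁), organ O-L1e-b «cross corner × a real wall at a split place» ((X-core) road: L1^m LH1-p03, L2^E this seat,
L3^m + head LH5-p02 (g4); dealer LH3-plan (g4) 2026-09-02T12:00:29Z).  The finset twin of part 1 of L2 (★ `ArchChartOrbGHeldOut`, ONE place `w₀` as a LOCAL quotient): here a
whole finset `E` of compact places is held out as ONE quotient of the product group `Π_{w ∉ S′, w ∈ E} U_w` by `Π T′_w` — the shape the m-place block descent L1^m consumes.

CONVENTIONS (`W` = complex places, `U_w = U(α)_w`, `T′_w = chartTorusGLoc α w S′`, `γ_w(c) = gprimeBlockAt α w S′ (c w)`, `e = archPiEquivCM`, `q_w = ν′_w ∕ t_w`): `E : Finset W` is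
ARBITRARY (places of `S′` take the split branch first, so only `E ∖ S′` is held out; no disjointness binder); the `E`-index is the NESTED subtype `ιE = {w : {w // w ∉ S′} // w.1 ∈ E}`
and the rest index `ιR = {w : {w // w ∉ S′} // w.1 ∉ E}` — both read into ★ (A4′) `contDiffOn_smoothModel_prod_param` with `e := fun w => w.1.1`, `he := fun w => w.1.2`;
`M_E = Π_{ιE} T′_w ≤ Π_{ιE} U_w`, `X_E = (Π_{ιE} U_w) ⧸ M_E` with Weil quotient measure `Q_E = (⊗_{ιE} ν′_w) ∕ ρ_E` (`ρ_E` any inversion-invariant Haar measure on `M_E` with coordinates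
`⊗ t_w`, ★ `exists_haar_map_subgroupPiCoords_eq_pi`), and the same with `R`.  The point of `Π_w U_w` is a plain three-way `dite` — no `Function.update`, no junk branch, no transport.
* §1 `exists_measurableEquiv_heldOutFinset` — `Φ : (Π_{S′} U⧸T′) × (Π_{∉S′} U⧸T′) ≃ᵐ (Π_{S′} U⧸T′) × (X_E × X_R)`, measure preserving `(⊗_{S′} q) ⊗ (⊗_{∉S′} q) → (⊗_{S′} q) ⊗ (Q_E ⊗ Q_R)`,
  with its three coordinate readings (Mathlib `piEquivPiSubtypeProd` at `w.1 ∈ E`, ★ `map_quotientPiHomeomorph_quotientMeasure_pi` on both halves); `heldOutFinset_point_eq` — the point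
  of `Π_w U_w` in held-out form; **`chartOrbG_eq_prod_mul_integral_pi_prod_heldOutFinset`** — HYPOTHESIS-FREE:
  `chartOrbG ν′ S′ a′ c = (∏_w t_w(B′_w)) · ∫ a′ (e⁻¹ (w ↦ [w ∈ S′] x_w γ_w(c) x_w⁻¹ ∣ [w ∈ E] (g γ_E(c) g⁻¹)_w ∣ [else] (g′ γ_R(c) g′⁻¹)_w)) d((⊗_{w∈S′} q_w) ⊗ (Q_E ⊗ Q_R))` — every `a′`, every `c`.
* §2 at a `G`-REGULAR `c` and `a′ ∈ C_c(G′_∞)`: `integrable_heldOutFinset_of_regG` and the ITERATED form **`chartOrbG_eq_prod_mul_integral_integral_heldOutFinset_of_regG`** — `X_E` OUTSIDE: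
  `… = (∏ t(B′)) · ∫_{X_E} ( ∫_{(Π_{S′} U⧸T′) × X_R} … ) dQ_E`.
HONEST LABEL: HC_CM is proved only modulo the 7 printed citations (2 remaining named inputs: hLiu418 = `stmt-HodgeConjecture-24832`, h413 = `stmt-HodgeConjecture-24833`) until rung 0
closes; count-neutral letter-L1 plumbing.

## References
* [Folland1995] G. B. Folland, *A Course in Abstract Harmonic Analysis* (1995), §2.2, §2.6 Thm. 2.49, (2.52).
* [Gelbart1975] S. Gelbart, *Automorphic Forms on Adele Groups*, Ann. of Math. Studies 83 (1975), §10 p. 155 (10.19); [Rogawski1990] J. D. Rogawski, *Automorphic Representations of Unitary Groups in Three Variables*, Ann. of Math. Stud. 123 (1990), §8.2 p. 122, §8.3 pp. 122–124.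
* [DeitmarEchterhoff2014] A. Deitmar, S. Echterhoff, *Principles of Harmonic Analysis*, 2nd ed. (2014), Thm. 1.5.3, Lemma 9.3.3.
-/

set_option autoImplicit false

noncomputable section
open MeasureTheory MeasureTheory.Measure Set NumberField NumberField.InfinitePlace Complex Topology
open Literature.MeasureTheory.Group Literature.NumberTheory.Rogawski1990 Literature.NumberTheory.Automorphic Literature.NumberTheory.Automorphic.UnitaryGroup
open Literature.NumberTheory.Automorphic.ArchCartan
open scoped ContDiff Classical ENNReal NNReal MatrixGroups

namespace Literature.NumberTheory.Automorphic.UnitaryGroup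

/-! ## §1 `chartOrbG` with a finset `E` of compact places HELD OUT as one quotient — hypothesis-free -/
section HeldOutFinset
variable (L : Type) [Field L] [NumberField L] [IsCMField L] (α : Fin 3 → L) (S' : Finset {w : InfinitePlace L // IsComplex w})
  [∀ w : {w : InfinitePlace L // IsComplex w}, MeasurableSpace ↥(archLocal L 3 (Matrix.diagonal α) w)]
  [∀ w : {w : InfinitePlace L // IsComplex w}, BorelSpace ↥(archLocal L 3 (Matrix.diagonal α) w)]
  [∀ w : {w : InfinitePlace L // IsComplex w}, LocallyCompactSpace ↥(archLocal L 3 (Matrix.diagonal α) w)]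
  [∀ w : {w : InfinitePlace L // IsComplex w}, SecondCountableTopology ↥(archLocal L 3 (Matrix.diagonal α) w)]
  [MeasurableSpace ↥(arch (↥(maximalRealSubfield L)) L (IsCMField.complexConj L) 3 (Matrix.diagonal α))]
  [BorelSpace ↥(arch (↥(maximalRealSubfield L)) L (IsCMField.complexConj L) 3 (Matrix.diagonal α))]
  [∀ w : {w : InfinitePlace L // IsComplex w}, MeasurableSpace (↥(archLocal L 3 (Matrix.diagonal α) w) ⧸ chartTorusGLoc L α w S')]
  [∀ w : {w : InfinitePlace L // IsComplex w}, BorelSpace (↥(archLocal L 3 (Matrix.diagonal α) w) ⧸ chartTorusGLoc L α w S')]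
  (ν'w : ∀ w : {w : InfinitePlace L // IsComplex w}, Measure ↥(archLocal L 3 (Matrix.diagonal α) w)) [∀ w, (ν'w w).IsHaarMeasure] [∀ w, (ν'w w).IsMulRightInvariant]
  (ν' : Measure ↥(arch (↥(maximalRealSubfield L)) L (IsCMField.complexConj L) 3 (Matrix.diagonal α))) [ν'.IsHaarMeasure] [ν'.IsMulRightInvariant]
  (hν : ν' = (Measure.pi ν'w).map (archPiEquivCM 3 L (Matrix.diagonal α)).symm)
  (t : ∀ w : {w : InfinitePlace L // IsComplex w}, Measure ↥(chartTorusGLoc L α w S')) [∀ w, (t w).IsHaarMeasure] [∀ w, (t w).IsInvInvariant]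
  -- the held-out finset `E` of places: `E`-factor `(Π_{w ∉ S′, w ∈ E} U_w) ⧸ Π T′_w` and rest factor `(Π_{w ∉ S′, w ∉ E} U_w) ⧸ Π T′_w`
  (E : Finset {w : InfinitePlace L // IsComplex w})
  [MeasurableSpace ((∀ w : {w : {w : {w : InfinitePlace L // IsComplex w} // w ∉ S'} // w.1 ∈ E}, ↥(archLocal L 3 (Matrix.diagonal α) w.1.1)) ⧸
            Subgroup.pi Set.univ (fun w : {w : {w : {w : InfinitePlace L // IsComplex w} // w ∉ S'} // w.1 ∈ E} => chartTorusGLoc L α w.1.1 S'))]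
  [BorelSpace ((∀ w : {w : {w : {w : InfinitePlace L // IsComplex w} // w ∉ S'} // w.1 ∈ E}, ↥(archLocal L 3 (Matrix.diagonal α) w.1.1)) ⧸
            Subgroup.pi Set.univ (fun w : {w : {w : {w : InfinitePlace L // IsComplex w} // w ∉ S'} // w.1 ∈ E} => chartTorusGLoc L α w.1.1 S'))]
  (ρE : Measure ↥(Subgroup.pi Set.univ (fun w : {w : {w : {w : InfinitePlace L // IsComplex w} // w ∉ S'} // w.1 ∈ E} => chartTorusGLoc L α w.1.1 S')))
  [ρE.IsHaarMeasure] [ρE.IsInvInvariant]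
  (hρE : Measure.map (subgroupPiCoords fun w : {w : {w : {w : InfinitePlace L // IsComplex w} // w ∉ S'} // w.1 ∈ E} => chartTorusGLoc L α w.1.1 S') ρE =
    Measure.pi fun w : {w : {w : {w : InfinitePlace L // IsComplex w} // w ∉ S'} // w.1 ∈ E} => t w.1.1)
  [MeasurableSpace ((∀ w : {w : {w : {w : InfinitePlace L // IsComplex w} // w ∉ S'} // w.1 ∉ E}, ↥(archLocal L 3 (Matrix.diagonal α) w.1.1)) ⧸
            Subgroup.pi Set.univ (fun w : {w : {w : {w : InfinitePlace L // IsComplex w} // w ∉ S'} // w.1 ∉ E} => chartTorusGLoc L α w.1.1 S'))]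
  [BorelSpace ((∀ w : {w : {w : {w : InfinitePlace L // IsComplex w} // w ∉ S'} // w.1 ∉ E}, ↥(archLocal L 3 (Matrix.diagonal α) w.1.1)) ⧸
            Subgroup.pi Set.univ (fun w : {w : {w : {w : InfinitePlace L // IsComplex w} // w ∉ S'} // w.1 ∉ E} => chartTorusGLoc L α w.1.1 S'))]
  (ρR : Measure ↥(Subgroup.pi Set.univ (fun w : {w : {w : {w : InfinitePlace L // IsComplex w} // w ∉ S'} // w.1 ∉ E} => chartTorusGLoc L α w.1.1 S')))
  [ρR.IsHaarMeasure] [ρR.IsInvInvariant]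
  (hρR : Measure.map (subgroupPiCoords fun w : {w : {w : {w : InfinitePlace L // IsComplex w} // w ∉ S'} // w.1 ∉ E} => chartTorusGLoc L α w.1.1 S') ρR =
    Measure.pi fun w : {w : {w : {w : InfinitePlace L // IsComplex w} // w ∉ S'} // w.1 ∉ E} => t w.1.1)

omit [MeasurableSpace ↥(arch (↥(maximalRealSubfield L)) L (IsCMField.complexConj L) 3 (Matrix.diagonal α))]
  [BorelSpace ↥(arch (↥(maximalRealSubfield L)) L (IsCMField.complexConj L) 3 (Matrix.diagonal α))] in
include hρE hρR in
/-- **THE FINSET-HELD-OUT COORDINATES ON THE COMPACT HALF** — a measure-preserving equivalence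
`Φ : (Π_{w∈S′} U_w⧸T′_w) × (Π_{w∉S′} U_w⧸T′_w) ≃ᵐ (Π_{w∈S′} U_w⧸T′_w) × (X_E × X_R)` from `(⊗_{S′} q_w) ⊗ (⊗_{∉S′} q_w)` to `(⊗_{S′} q_w) ⊗ (Q_E ⊗ Q_R)` READING
`Φ(x).1 = x.1`, `Φ(x).2.1 = qπ_E⁻¹ (x.2|_E)`, `Φ(x).2.2 = qπ_R⁻¹ (x.2|_R)` (`qπ` = ★ `quotientPiHomeomorph`): Mathlib `piEquivPiSubtypeProd` at `w.1 ∈ E` on the compact half,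
★ `map_quotientPiHomeomorph_quotientMeasure_pi` (`hρE`, `hρR`) on both halves. [cite: Folland1995, §2.2; §2.6 Thm. 2.49, (2.52)] -/
theorem exists_measurableEquiv_heldOutFinset :
    ∃ Φ : ((∀ w : {w : {w : InfinitePlace L // IsComplex w} // w ∈ S'}, ↥(archLocal L 3 (Matrix.diagonal α) w.1) ⧸ chartTorusGLoc L α w.1 S') ×
        (∀ w : {w : {w : InfinitePlace L // IsComplex w} // w ∉ S'}, ↥(archLocal L 3 (Matrix.diagonal α) w.1) ⧸ chartTorusGLoc L α w.1 S')) ≃ᵐ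
      ((∀ w : {w : {w : InfinitePlace L // IsComplex w} // w ∈ S'}, ↥(archLocal L 3 (Matrix.diagonal α) w.1) ⧸ chartTorusGLoc L α w.1 S') ×
        (((∀ w : {w : {w : {w : InfinitePlace L // IsComplex w} // w ∉ S'} // w.1 ∈ E}, ↥(archLocal L 3 (Matrix.diagonal α) w.1.1)) ⧸
            Subgroup.pi Set.univ (fun w : {w : {w : {w : InfinitePlace L // IsComplex w} // w ∉ S'} // w.1 ∈ E} => chartTorusGLoc L α w.1.1 S')) ×
          ((∀ w : {w : {w : {w : InfinitePlace L // IsComplex w} // w ∉ S'} // w.1 ∉ E}, ↥(archLocal L 3 (Matrix.diagonal α) w.1.1)) ⧸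
            Subgroup.pi Set.univ (fun w : {w : {w : {w : InfinitePlace L // IsComplex w} // w ∉ S'} // w.1 ∉ E} => chartTorusGLoc L α w.1.1 S')))),
      MeasurePreserving Φ
        ((Measure.pi fun w : {w : {w : InfinitePlace L // IsComplex w} // w ∈ S'} =>
          quotientMeasure (chartTorusGLoc L α w.1 S') (t w.1) (isClosed_chartTorusGLoc L α w.1 S') (ν'w w.1)).prod
        (Measure.pi fun w : {w : {w : InfinitePlace L // IsComplex w} // w ∉ S'} =>
          quotientMeasure (chartTorusGLoc L α w.1 S') (t w.1) (isClosed_chartTorusGLoc L α w.1 S') (ν'w w.1)))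
        ((Measure.pi fun w : {w : {w : InfinitePlace L // IsComplex w} // w ∈ S'} =>
          quotientMeasure (chartTorusGLoc L α w.1 S') (t w.1) (isClosed_chartTorusGLoc L α w.1 S') (ν'w w.1)).prod
        ((quotientMeasure (Subgroup.pi Set.univ (fun w : {w : {w : {w : InfinitePlace L // IsComplex w} // w ∉ S'} // w.1 ∈ E} => chartTorusGLoc L α w.1.1 S')) ρE
            (isClosed_coe_pi _ fun w => isClosed_chartTorusGLoc L α w.1.1 S')
            (Measure.pi fun w : {w : {w : {w : InfinitePlace L // IsComplex w} // w ∉ S'} // w.1 ∈ E} => ν'w w.1.1)).prod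
          (quotientMeasure (Subgroup.pi Set.univ (fun w : {w : {w : {w : InfinitePlace L // IsComplex w} // w ∉ S'} // w.1 ∉ E} => chartTorusGLoc L α w.1.1 S')) ρR
            (isClosed_coe_pi _ fun w => isClosed_chartTorusGLoc L α w.1.1 S')
            (Measure.pi fun w : {w : {w : {w : InfinitePlace L // IsComplex w} // w ∉ S'} // w.1 ∉ E} => ν'w w.1.1)))) ∧
      ∀ x, (Φ x).1 = x.1 ∧
        (Φ x).2.1 = (quotientPiHomeomorph fun w : {w : {w : {w : InfinitePlace L // IsComplex w} // w ∉ S'} // w.1 ∈ E} => chartTorusGLoc L α w.1.1 S').symm (fun w : {w : {w : {w : InfinitePlace L // IsComplex w} // w ∉ S'} // w.1 ∈ E} => x.2 w.1) ∧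
        (Φ x).2.2 = (quotientPiHomeomorph fun w : {w : {w : {w : InfinitePlace L // IsComplex w} // w ∉ S'} // w.1 ∉ E} => chartTorusGLoc L α w.1.1 S').symm (fun w : {w : {w : {w : InfinitePlace L // IsComplex w} // w ∉ S'} // w.1 ∉ E} => x.2 w.1) := by
  haveI : ∀ w : {w : InfinitePlace L // IsComplex w}, IsClosed (chartTorusGLoc L α w S' : Set ↥(archLocal L 3 (Matrix.diagonal α) w)) :=
    fun w => isClosed_chartTorusGLoc L α w S'
  haveI : ∀ w : {w : InfinitePlace L // IsComplex w}, SecondCountableTopology (↥(archLocal L 3 (Matrix.diagonal α) w) ⧸ chartTorusGLoc L α w S') := fun w => inferInstance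
  haveI : ∀ w : {w : InfinitePlace L // IsComplex w},
      SigmaFinite (quotientMeasure (chartTorusGLoc L α w S') (t w) (isClosed_chartTorusGLoc L α w S') (ν'w w)) := fun w => inferInstance
  haveI : ∀ w, LocallyCompactSpace ↥(chartTorusGLoc L α w S') := fun w => locallyCompactSpace_chartTorusGLoc L α w S'
  haveI : ∀ w, SecondCountableTopology ↥(chartTorusGLoc L α w S') := fun w => TopologicalSpace.Subtype.secondCountableTopology _
  haveI : ∀ w, SigmaFinite (t w) := fun w => inferInstance
  have hMcE : IsClosed ((Subgroup.pi Set.univ (fun w : {w : {w : {w : InfinitePlace L // IsComplex w} // w ∉ S'} // w.1 ∈ E} => chartTorusGLoc L α w.1.1 S')) :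
      Set (∀ w : {w : {w : {w : InfinitePlace L // IsComplex w} // w ∉ S'} // w.1 ∈ E}, ↥(archLocal L 3 (Matrix.diagonal α) w.1.1))) :=
    isClosed_coe_pi _ fun w => isClosed_chartTorusGLoc L α w.1.1 S'
  haveI : LocallyCompactSpace ↥(Subgroup.pi Set.univ (fun w : {w : {w : {w : InfinitePlace L // IsComplex w} // w ∉ S'} // w.1 ∈ E} => chartTorusGLoc L α w.1.1 S')) :=
    hMcE.isClosedEmbedding_subtypeVal.locallyCompactSpace
  haveI : SecondCountableTopology ↥(Subgroup.pi Set.univ (fun w : {w : {w : {w : InfinitePlace L // IsComplex w} // w ∉ S'} // w.1 ∈ E} => chartTorusGLoc L α w.1.1 S')) :=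
    TopologicalSpace.Subtype.secondCountableTopology _
  haveI : SFinite ρE := inferInstance
  have hMcR : IsClosed ((Subgroup.pi Set.univ (fun w : {w : {w : {w : InfinitePlace L // IsComplex w} // w ∉ S'} // w.1 ∉ E} => chartTorusGLoc L α w.1.1 S')) :
      Set (∀ w : {w : {w : {w : InfinitePlace L // IsComplex w} // w ∉ S'} // w.1 ∉ E}, ↥(archLocal L 3 (Matrix.diagonal α) w.1.1))) :=
    isClosed_coe_pi _ fun w => isClosed_chartTorusGLoc L α w.1.1 S'
  haveI : LocallyCompactSpace ↥(Subgroup.pi Set.univ (fun w : {w : {w : {w : InfinitePlace L // IsComplex w} // w ∉ S'} // w.1 ∉ E} => chartTorusGLoc L α w.1.1 S')) :=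
    hMcR.isClosedEmbedding_subtypeVal.locallyCompactSpace
  haveI : SecondCountableTopology ↥(Subgroup.pi Set.univ (fun w : {w : {w : {w : InfinitePlace L // IsComplex w} // w ∉ S'} // w.1 ∉ E} => chartTorusGLoc L α w.1.1 S')) :=
    TopologicalSpace.Subtype.secondCountableTopology _
  haveI : SFinite ρR := inferInstance
  -- the measure-preserving pieces on the compact half: index split at `w.1 ∈ E`, each part as ONE quotient
  have hsplit := measurePreserving_piEquivPiSubtypeProd'
    (fun w : {w : {w : InfinitePlace L // IsComplex w} // w ∉ S'} =>
      quotientMeasure (chartTorusGLoc L α w.1 S') (t w.1) (isClosed_chartTorusGLoc L α w.1 S') (ν'w w.1))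
    (fun w : {w : {w : InfinitePlace L // IsComplex w} // w ∉ S'} => w.1 ∈ E)
  have hqE : MeasurePreserving (quotientPiHomeomorph fun w : {w : {w : {w : InfinitePlace L // IsComplex w} // w ∉ S'} // w.1 ∈ E} => chartTorusGLoc L α w.1.1 S').symm.toMeasurableEquiv
      (Measure.pi fun w : {w : {w : {w : InfinitePlace L // IsComplex w} // w ∉ S'} // w.1 ∈ E} =>
        quotientMeasure (chartTorusGLoc L α w.1.1 S') (t w.1.1) (isClosed_chartTorusGLoc L α w.1.1 S') (ν'w w.1.1))
      (quotientMeasure (Subgroup.pi Set.univ (fun w : {w : {w : {w : InfinitePlace L // IsComplex w} // w ∉ S'} // w.1 ∈ E} => chartTorusGLoc L α w.1.1 S')) ρE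
            (isClosed_coe_pi _ fun w => isClosed_chartTorusGLoc L α w.1.1 S')
            (Measure.pi fun w : {w : {w : {w : InfinitePlace L // IsComplex w} // w ∉ S'} // w.1 ∈ E} => ν'w w.1.1)) := by
    refine MeasurePreserving.symm _ ⟨(quotientPiHomeomorph fun w : {w : {w : {w : InfinitePlace L // IsComplex w} // w ∉ S'} // w.1 ∈ E} => chartTorusGLoc L α w.1.1 S').toMeasurableEquiv.measurable, ?_⟩
    rw [Homeomorph.toMeasurableEquiv_coe]
    exact map_quotientPiHomeomorph_quotientMeasure_pi (fun w : {w : {w : {w : InfinitePlace L // IsComplex w} // w ∉ S'} // w.1 ∈ E} => chartTorusGLoc L α w.1.1 S')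
      (fun w => isClosed_chartTorusGLoc L α w.1.1 S') (fun w => t w.1.1) ρE hρE (fun w => ν'w w.1.1)
  have hqR : MeasurePreserving (quotientPiHomeomorph fun w : {w : {w : {w : InfinitePlace L // IsComplex w} // w ∉ S'} // w.1 ∉ E} => chartTorusGLoc L α w.1.1 S').symm.toMeasurableEquiv
      (Measure.pi fun w : {w : {w : {w : InfinitePlace L // IsComplex w} // w ∉ S'} // w.1 ∉ E} =>
        quotientMeasure (chartTorusGLoc L α w.1.1 S') (t w.1.1) (isClosed_chartTorusGLoc L α w.1.1 S') (ν'w w.1.1))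
      (quotientMeasure (Subgroup.pi Set.univ (fun w : {w : {w : {w : InfinitePlace L // IsComplex w} // w ∉ S'} // w.1 ∉ E} => chartTorusGLoc L α w.1.1 S')) ρR
            (isClosed_coe_pi _ fun w => isClosed_chartTorusGLoc L α w.1.1 S')
            (Measure.pi fun w : {w : {w : {w : InfinitePlace L // IsComplex w} // w ∉ S'} // w.1 ∉ E} => ν'w w.1.1)) := by
    refine MeasurePreserving.symm _ ⟨(quotientPiHomeomorph fun w : {w : {w : {w : InfinitePlace L // IsComplex w} // w ∉ S'} // w.1 ∉ E} => chartTorusGLoc L α w.1.1 S').toMeasurableEquiv.measurable, ?_⟩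
    rw [Homeomorph.toMeasurableEquiv_coe]
    exact map_quotientPiHomeomorph_quotientMeasure_pi (fun w : {w : {w : {w : InfinitePlace L // IsComplex w} // w ∉ S'} // w.1 ∉ E} => chartTorusGLoc L α w.1.1 S')
      (fun w => isClosed_chartTorusGLoc L α w.1.1 S') (fun w => t w.1.1) ρR hρR (fun w => ν'w w.1.1)
  refine ⟨MeasurableEquiv.prodCongr (MeasurableEquiv.refl _)
      ((MeasurableEquiv.piEquivPiSubtypeProd
          (fun w : {w : {w : InfinitePlace L // IsComplex w} // w ∉ S'} => ↥(archLocal L 3 (Matrix.diagonal α) w.1) ⧸ chartTorusGLoc L α w.1 S')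
          (fun w : {w : {w : InfinitePlace L // IsComplex w} // w ∉ S'} => w.1 ∈ E)).trans
        (MeasurableEquiv.prodCongr
          (quotientPiHomeomorph fun w : {w : {w : {w : InfinitePlace L // IsComplex w} // w ∉ S'} // w.1 ∈ E} => chartTorusGLoc L α w.1.1 S').symm.toMeasurableEquiv
          (quotientPiHomeomorph fun w : {w : {w : {w : InfinitePlace L // IsComplex w} // w ∉ S'} // w.1 ∉ E} => chartTorusGLoc L α w.1.1 S').symm.toMeasurableEquiv)),
    (MeasurePreserving.id _).prod ((hqE.prod hqR).comp hsplit), fun x => ⟨rfl, rfl, rfl⟩⟩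

omit [∀ w : {w : InfinitePlace L // IsComplex w}, MeasurableSpace ↥(archLocal L 3 (Matrix.diagonal α) w)]
  [∀ w : {w : InfinitePlace L // IsComplex w}, BorelSpace ↥(archLocal L 3 (Matrix.diagonal α) w)]
  [∀ w : {w : InfinitePlace L // IsComplex w}, LocallyCompactSpace ↥(archLocal L 3 (Matrix.diagonal α) w)]
  [∀ w : {w : InfinitePlace L // IsComplex w}, SecondCountableTopology ↥(archLocal L 3 (Matrix.diagonal α) w)]
  [MeasurableSpace ↥(arch (↥(maximalRealSubfield L)) L (IsCMField.complexConj L) 3 (Matrix.diagonal α))]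
  [BorelSpace ↥(arch (↥(maximalRealSubfield L)) L (IsCMField.complexConj L) 3 (Matrix.diagonal α))]
  [∀ w : {w : InfinitePlace L // IsComplex w}, MeasurableSpace (↥(archLocal L 3 (Matrix.diagonal α) w) ⧸ chartTorusGLoc L α w S')]
  [∀ w : {w : InfinitePlace L // IsComplex w}, BorelSpace (↥(archLocal L 3 (Matrix.diagonal α) w) ⧸ chartTorusGLoc L α w S')]
  [MeasurableSpace ((∀ w : {w : {w : {w : InfinitePlace L // IsComplex w} // w ∉ S'} // w.1 ∈ E}, ↥(archLocal L 3 (Matrix.diagonal α) w.1.1)) ⧸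
            Subgroup.pi Set.univ (fun w : {w : {w : {w : InfinitePlace L // IsComplex w} // w ∉ S'} // w.1 ∈ E} => chartTorusGLoc L α w.1.1 S'))]
  [BorelSpace ((∀ w : {w : {w : {w : InfinitePlace L // IsComplex w} // w ∉ S'} // w.1 ∈ E}, ↥(archLocal L 3 (Matrix.diagonal α) w.1.1)) ⧸
            Subgroup.pi Set.univ (fun w : {w : {w : {w : InfinitePlace L // IsComplex w} // w ∉ S'} // w.1 ∈ E} => chartTorusGLoc L α w.1.1 S'))]
  [MeasurableSpace ((∀ w : {w : {w : {w : InfinitePlace L // IsComplex w} // w ∉ S'} // w.1 ∉ E}, ↥(archLocal L 3 (Matrix.diagonal α) w.1.1)) ⧸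
            Subgroup.pi Set.univ (fun w : {w : {w : {w : InfinitePlace L // IsComplex w} // w ∉ S'} // w.1 ∉ E} => chartTorusGLoc L α w.1.1 S'))]
  [BorelSpace ((∀ w : {w : {w : {w : InfinitePlace L // IsComplex w} // w ∉ S'} // w.1 ∉ E}, ↥(archLocal L 3 (Matrix.diagonal α) w.1.1)) ⧸
            Subgroup.pi Set.univ (fun w : {w : {w : {w : InfinitePlace L // IsComplex w} // w ∉ S'} // w.1 ∉ E} => chartTorusGLoc L α w.1.1 S'))] in
/-- **THE FINSET-HELD-OUT READING OF A POINT** (pure bookkeeping, no measure): for classes `x₁` at the split places and `x₂` at the compact places,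
`(w ↦ z_w γ_w(c) z_w⁻¹)` (`z = x₁` on `S′`, `= x₂` off `S′`, the (A1) §2 point) EQUALS `w ↦ [w ∈ S′] x₁,w γ_w x₁,w⁻¹ ∣ [w ∈ E] (G_E γ_E(c) G_E⁻¹)_w ∣ [else] (G_R γ_R(c) G_R⁻¹)_w` with
`G_E M_E = qπ_E⁻¹ (x₂|_E)`, `G_R M_R = qπ_R⁻¹ (x₂|_R)` (★ `quotientPiEquiv_mk`, ★ `descConj_mk`). [cite: Rogawski1990, §8.2 p. 122] -/
theorem heldOutFinset_point_eq (c : {w : InfinitePlace L // IsComplex w} → Fin 3 → ℝ)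
    (x₁ : ∀ w : {w : {w : InfinitePlace L // IsComplex w} // w ∈ S'}, ↥(archLocal L 3 (Matrix.diagonal α) w.1) ⧸ chartTorusGLoc L α w.1 S')
    (x₂ : ∀ w : {w : {w : InfinitePlace L // IsComplex w} // w ∉ S'}, ↥(archLocal L 3 (Matrix.diagonal α) w.1) ⧸ chartTorusGLoc L α w.1 S') :
    (fun w : {w : InfinitePlace L // IsComplex w} =>
      descConj (gprimeBlockAt L α w S' (c w)) (chartTorusGLoc L α w S') (forall_mem_chartTorusGLoc_comm L α w S' (c w)) id
        (if h : w ∈ S' then x₁ ⟨w, h⟩ else x₂ ⟨w, h⟩)) =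
      fun w =>
            if h : w ∈ S' then
              descConj (gprimeBlockAt L α w S' (c w)) (chartTorusGLoc L α w S') (forall_mem_chartTorusGLoc_comm L α w S' (c w)) id (x₁ ⟨w, h⟩)
            else if hE : w ∈ E then
              descConj (fun w : {w : {w : {w : InfinitePlace L // IsComplex w} // w ∉ S'} // w.1 ∈ E} => gprimeBlock L α w.1.1 S' c)
                (Subgroup.pi Set.univ (fun w : {w : {w : {w : InfinitePlace L // IsComplex w} // w ∉ S'} // w.1 ∈ E} => chartTorusGLoc L α w.1.1 S'))
                (forall_mem_pi_chartTorusGLoc_comm L α S' (fun w : {w : {w : {w : InfinitePlace L // IsComplex w} // w ∉ S'} // w.1 ∈ E} => w.1.1) c)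
                (fun g => (g ⟨⟨w, h⟩, hE⟩ : ↥(archLocal L 3 (Matrix.diagonal α) w))) ((quotientPiHomeomorph fun w : {w : {w : {w : InfinitePlace L // IsComplex w} // w ∉ S'} // w.1 ∈ E} => chartTorusGLoc L α w.1.1 S').symm (fun w : {w : {w : {w : InfinitePlace L // IsComplex w} // w ∉ S'} // w.1 ∈ E} => x₂ w.1))
            else
              descConj (fun w : {w : {w : {w : InfinitePlace L // IsComplex w} // w ∉ S'} // w.1 ∉ E} => gprimeBlock L α w.1.1 S' c)
                (Subgroup.pi Set.univ (fun w : {w : {w : {w : InfinitePlace L // IsComplex w} // w ∉ S'} // w.1 ∉ E} => chartTorusGLoc L α w.1.1 S'))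
                (forall_mem_pi_chartTorusGLoc_comm L α S' (fun w : {w : {w : {w : InfinitePlace L // IsComplex w} // w ∉ S'} // w.1 ∉ E} => w.1.1) c)
                (fun g => (g ⟨⟨w, h⟩, hE⟩ : ↥(archLocal L 3 (Matrix.diagonal α) w))) ((quotientPiHomeomorph fun w : {w : {w : {w : InfinitePlace L // IsComplex w} // w ∉ S'} // w.1 ∉ E} => chartTorusGLoc L α w.1.1 S').symm (fun w : {w : {w : {w : InfinitePlace L // IsComplex w} // w ∉ S'} // w.1 ∉ E} => x₂ w.1)) := by
  -- representatives of the two classes, read back coordinate-wise through `qπ`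
  obtain ⟨GE, hGE⟩ := QuotientGroup.mk_surjective ((quotientPiHomeomorph fun w : {w : {w : {w : InfinitePlace L // IsComplex w} // w ∉ S'} // w.1 ∈ E} => chartTorusGLoc L α w.1.1 S').symm (fun w : {w : {w : {w : InfinitePlace L // IsComplex w} // w ∉ S'} // w.1 ∈ E} => x₂ w.1))
  have hzE : ∀ (w : {w : InfinitePlace L // IsComplex w}) (h : w ∉ S') (hE : w ∈ E),
      x₂ ⟨w, h⟩ = (quotientPiHomeomorph fun w : {w : {w : {w : InfinitePlace L // IsComplex w} // w ∉ S'} // w.1 ∈ E} => chartTorusGLoc L α w.1.1 S') (QuotientGroup.mk GE) ⟨⟨w, h⟩, hE⟩ := by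
    intro w h hE
    have hGw := congrFun (congrArg (quotientPiHomeomorph fun w : {w : {w : {w : InfinitePlace L // IsComplex w} // w ∉ S'} // w.1 ∈ E} => chartTorusGLoc L α w.1.1 S') hGE) ⟨⟨w, h⟩, hE⟩
    rw [Homeomorph.apply_symm_apply] at hGw
    exact hGw.symm
  obtain ⟨GR, hGR⟩ := QuotientGroup.mk_surjective ((quotientPiHomeomorph fun w : {w : {w : {w : InfinitePlace L // IsComplex w} // w ∉ S'} // w.1 ∉ E} => chartTorusGLoc L α w.1.1 S').symm (fun w : {w : {w : {w : InfinitePlace L // IsComplex w} // w ∉ S'} // w.1 ∉ E} => x₂ w.1))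
  have hzR : ∀ (w : {w : InfinitePlace L // IsComplex w}) (h : w ∉ S') (hE : w ∉ E),
      x₂ ⟨w, h⟩ = (quotientPiHomeomorph fun w : {w : {w : {w : InfinitePlace L // IsComplex w} // w ∉ S'} // w.1 ∉ E} => chartTorusGLoc L α w.1.1 S') (QuotientGroup.mk GR) ⟨⟨w, h⟩, hE⟩ := by
    intro w h hE
    have hGw := congrFun (congrArg (quotientPiHomeomorph fun w : {w : {w : {w : InfinitePlace L // IsComplex w} // w ∉ S'} // w.1 ∉ E} => chartTorusGLoc L α w.1.1 S') hGR) ⟨⟨w, h⟩, hE⟩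
    rw [Homeomorph.apply_symm_apply] at hGw
    exact hGw.symm
  rw [← hGE, ← hGR]
  funext w
  by_cases h : w ∈ S'
  · rw [dif_pos h, dif_pos h]
  · by_cases hE : w ∈ E
    · rw [dif_neg h, dif_neg h, dif_pos hE, hzE w h hE, descConj_mk, coe_quotientPiHomeomorph, quotientPiEquiv_mk, descConj_mk]
      rfl
    · rw [dif_neg h, dif_neg h, dif_neg hE, hzR w h hE, descConj_mk, coe_quotientPiHomeomorph, quotientPiEquiv_mk, descConj_mk]
      rfl

include hν hρE hρR in
/-- **(A1′)^E `chartOrbG` WITH A FINSET `E` OF COMPACT PLACES HELD OUT — HYPOTHESIS-FREE.**  For admissible `S′` (`hα`, `hS′`), ANY inversion-invariant Haar family `t_w` on the local chart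
tori, ANY finset `E` of places, and inversion-invariant Haar measures `ρ_E`, `ρ_R` on `M_E := Π_{w ∉ S′, w ∈ E} T′_w`, `M_R := Π_{w ∉ S′, w ∉ E} T′_w` with coordinates `⊗ t_w` (`hρE`, `hρR`),
EVERY test function `a′` and EVERY coordinate `c`:
`chartOrbG ν′ S′ a′ c = (∏_w t_w(B′_w)) · ∫ a′ (e⁻¹ (w ↦ [w ∈ S′] x_w γ_w(c) x_w⁻¹ ∣ [w ∈ E] (g γ_E(c) g⁻¹)_w ∣ [else] (g′ γ_R(c) g′⁻¹)_w)) d((⊗_{w∈S′} q_w) ⊗ (Q_E ⊗ Q_R))(x, gM_E, g′M_R)` —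
the split variables in LOCAL `descConj (γ_w(c)) T′_w _ id` currency, the held-out places through ONE `descConj (γ_E(c)) M_E _` on `Π_{ιE} U_w` (what L1^m descends), the rest through ONE
`descConj (γ_R(c)) M_R _` (what ★ (A4′) differentiates).  ★ (A1) §2 + `exists_measurableEquiv_heldOutFinset` + `heldOutFinset_point_eq`.
[cite: Folland1995, §2.6 Thm. 2.49, (2.52)] [cite: Gelbart1975, p. 155 (10.19)] [cite: Rogawski1990, §8.2 p. 122; §8.3 p. 124] -/
theorem chartOrbG_eq_prod_mul_integral_pi_prod_heldOutFinset (hα : ∀ i, α i ≠ 0) (hS' : ∀ w, w ∈ S' → w ∈ splitChartPlaces L α)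
    (a' : ↥(arch (↥(maximalRealSubfield L)) L (IsCMField.complexConj L) 3 (Matrix.diagonal α)) → ℂ)
    (c : {w : InfinitePlace L // IsComplex w} → Fin 3 → ℝ) :
    chartOrbG L α ν' S' a' c =
      (∏ w, ((t w (chartBoxImgGLoc L α w S')).toReal : ℂ)) *
        ∫ x : (∀ w : {w : {w : InfinitePlace L // IsComplex w} // w ∈ S'}, ↥(archLocal L 3 (Matrix.diagonal α) w.1) ⧸ chartTorusGLoc L α w.1 S') ×
            (((∀ w : {w : {w : {w : InfinitePlace L // IsComplex w} // w ∉ S'} // w.1 ∈ E}, ↥(archLocal L 3 (Matrix.diagonal α) w.1.1)) ⧸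
            Subgroup.pi Set.univ (fun w : {w : {w : {w : InfinitePlace L // IsComplex w} // w ∉ S'} // w.1 ∈ E} => chartTorusGLoc L α w.1.1 S')) ×
              ((∀ w : {w : {w : {w : InfinitePlace L // IsComplex w} // w ∉ S'} // w.1 ∉ E}, ↥(archLocal L 3 (Matrix.diagonal α) w.1.1)) ⧸
            Subgroup.pi Set.univ (fun w : {w : {w : {w : InfinitePlace L // IsComplex w} // w ∉ S'} // w.1 ∉ E} => chartTorusGLoc L α w.1.1 S'))),
          a' ((archPiEquivCM 3 L (Matrix.diagonal α)).symm (fun w =>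
            if h : w ∈ S' then
              descConj (gprimeBlockAt L α w S' (c w)) (chartTorusGLoc L α w S') (forall_mem_chartTorusGLoc_comm L α w S' (c w)) id (x.1 ⟨w, h⟩)
            else if hE : w ∈ E then
              descConj (fun w : {w : {w : {w : InfinitePlace L // IsComplex w} // w ∉ S'} // w.1 ∈ E} => gprimeBlock L α w.1.1 S' c)
                (Subgroup.pi Set.univ (fun w : {w : {w : {w : InfinitePlace L // IsComplex w} // w ∉ S'} // w.1 ∈ E} => chartTorusGLoc L α w.1.1 S'))
                (forall_mem_pi_chartTorusGLoc_comm L α S' (fun w : {w : {w : {w : InfinitePlace L // IsComplex w} // w ∉ S'} // w.1 ∈ E} => w.1.1) c)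
                (fun g => (g ⟨⟨w, h⟩, hE⟩ : ↥(archLocal L 3 (Matrix.diagonal α) w))) x.2.1
            else
              descConj (fun w : {w : {w : {w : InfinitePlace L // IsComplex w} // w ∉ S'} // w.1 ∉ E} => gprimeBlock L α w.1.1 S' c)
                (Subgroup.pi Set.univ (fun w : {w : {w : {w : InfinitePlace L // IsComplex w} // w ∉ S'} // w.1 ∉ E} => chartTorusGLoc L α w.1.1 S'))
                (forall_mem_pi_chartTorusGLoc_comm L α S' (fun w : {w : {w : {w : InfinitePlace L // IsComplex w} // w ∉ S'} // w.1 ∉ E} => w.1.1) c)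
                (fun g => (g ⟨⟨w, h⟩, hE⟩ : ↥(archLocal L 3 (Matrix.diagonal α) w))) x.2.2))
          ∂((Measure.pi fun w : {w : {w : InfinitePlace L // IsComplex w} // w ∈ S'} =>
          quotientMeasure (chartTorusGLoc L α w.1 S') (t w.1) (isClosed_chartTorusGLoc L α w.1 S') (ν'w w.1)).prod
        ((quotientMeasure (Subgroup.pi Set.univ (fun w : {w : {w : {w : InfinitePlace L // IsComplex w} // w ∉ S'} // w.1 ∈ E} => chartTorusGLoc L α w.1.1 S')) ρE
            (isClosed_coe_pi _ fun w => isClosed_chartTorusGLoc L α w.1.1 S')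
            (Measure.pi fun w : {w : {w : {w : InfinitePlace L // IsComplex w} // w ∉ S'} // w.1 ∈ E} => ν'w w.1.1)).prod
          (quotientMeasure (Subgroup.pi Set.univ (fun w : {w : {w : {w : InfinitePlace L // IsComplex w} // w ∉ S'} // w.1 ∉ E} => chartTorusGLoc L α w.1.1 S')) ρR
            (isClosed_coe_pi _ fun w => isClosed_chartTorusGLoc L α w.1.1 S')
            (Measure.pi fun w : {w : {w : {w : InfinitePlace L // IsComplex w} // w ∉ S'} // w.1 ∉ E} => ν'w w.1.1)))) := by
  haveI : ∀ w : {w : InfinitePlace L // IsComplex w}, SecondCountableTopology (↥(archLocal L 3 (Matrix.diagonal α) w) ⧸ chartTorusGLoc L α w S') := fun w => inferInstance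
  haveI : ∀ w : {w : InfinitePlace L // IsComplex w},
      SigmaFinite (quotientMeasure (chartTorusGLoc L α w S') (t w) (isClosed_chartTorusGLoc L α w S') (ν'w w)) := fun w => inferInstance
  rw [chartOrbG_eq_prod_mul_integral_prod_pi L α S' ν'w ν' hν t hα hS' a' c]
  congr 1
  obtain ⟨Φ, hΦ, hΦx⟩ := exists_measurableEquiv_heldOutFinset L α S' ν'w t E ρE hρE ρR hρR
  rw [← hΦ.integral_comp' (f := Φ)]
  refine integral_congr_ae (Filter.Eventually.of_forall fun x => ?_)
  obtain ⟨x₁, x₂⟩ := x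
  obtain ⟨h1, h2, h3⟩ := hΦx (x₁, x₂)
  dsimp only
  rw [h1, h2, h3, heldOutFinset_point_eq L α S' E c x₁ x₂]

/-! ## §2 At a `G`-regular point: integrability of the held-out integrand and the ITERATED form, `X_E` OUTSIDE -/
include hν hρE hρR in
/-- **The finset-held-out integrand of §1 is integrable at every `G`-REGULAR `c` for `a′ ∈ C_c(G′_∞)`** — ★ (A1) `integrable_comp_symm_archPiEquivCM_descConj_pi_of_regG` transported
along Mathlib `piEquivPiSubtypeProd` and the held-out coordinates `Φ` (`MeasurePreserving.integrable_comp_emb`). [cite: Rogawski1990, §8.3 p. 122] [cite: DeitmarEchterhoff2014, Lemma 9.3.3] -/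
theorem integrable_heldOutFinset_of_regG (hα : ∀ i, α i ≠ 0) (hS' : ∀ w, w ∈ S' → w ∈ splitChartPlaces L α)
    {c : {w : InfinitePlace L // IsComplex w} → Fin 3 → ℝ} (hc : c ∈ RegG S')
    {a' : ↥(arch (↥(maximalRealSubfield L)) L (IsCMField.complexConj L) 3 (Matrix.diagonal α)) → ℂ} (ha'c : Continuous a') (ha's : HasCompactSupport a') :
    Integrable (fun x : (∀ w : {w : {w : InfinitePlace L // IsComplex w} // w ∈ S'}, ↥(archLocal L 3 (Matrix.diagonal α) w.1) ⧸ chartTorusGLoc L α w.1 S') ×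
            (((∀ w : {w : {w : {w : InfinitePlace L // IsComplex w} // w ∉ S'} // w.1 ∈ E}, ↥(archLocal L 3 (Matrix.diagonal α) w.1.1)) ⧸
            Subgroup.pi Set.univ (fun w : {w : {w : {w : InfinitePlace L // IsComplex w} // w ∉ S'} // w.1 ∈ E} => chartTorusGLoc L α w.1.1 S')) ×
              ((∀ w : {w : {w : {w : InfinitePlace L // IsComplex w} // w ∉ S'} // w.1 ∉ E}, ↥(archLocal L 3 (Matrix.diagonal α) w.1.1)) ⧸
            Subgroup.pi Set.univ (fun w : {w : {w : {w : InfinitePlace L // IsComplex w} // w ∉ S'} // w.1 ∉ E} => chartTorusGLoc L α w.1.1 S'))) =>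
          a' ((archPiEquivCM 3 L (Matrix.diagonal α)).symm (fun w =>
            if h : w ∈ S' then
              descConj (gprimeBlockAt L α w S' (c w)) (chartTorusGLoc L α w S') (forall_mem_chartTorusGLoc_comm L α w S' (c w)) id (x.1 ⟨w, h⟩)
            else if hE : w ∈ E then
              descConj (fun w : {w : {w : {w : InfinitePlace L // IsComplex w} // w ∉ S'} // w.1 ∈ E} => gprimeBlock L α w.1.1 S' c)
                (Subgroup.pi Set.univ (fun w : {w : {w : {w : InfinitePlace L // IsComplex w} // w ∉ S'} // w.1 ∈ E} => chartTorusGLoc L α w.1.1 S'))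
                (forall_mem_pi_chartTorusGLoc_comm L α S' (fun w : {w : {w : {w : InfinitePlace L // IsComplex w} // w ∉ S'} // w.1 ∈ E} => w.1.1) c)
                (fun g => (g ⟨⟨w, h⟩, hE⟩ : ↥(archLocal L 3 (Matrix.diagonal α) w))) x.2.1
            else
              descConj (fun w : {w : {w : {w : InfinitePlace L // IsComplex w} // w ∉ S'} // w.1 ∉ E} => gprimeBlock L α w.1.1 S' c)
                (Subgroup.pi Set.univ (fun w : {w : {w : {w : InfinitePlace L // IsComplex w} // w ∉ S'} // w.1 ∉ E} => chartTorusGLoc L α w.1.1 S'))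
                (forall_mem_pi_chartTorusGLoc_comm L α S' (fun w : {w : {w : {w : InfinitePlace L // IsComplex w} // w ∉ S'} // w.1 ∉ E} => w.1.1) c)
                (fun g => (g ⟨⟨w, h⟩, hE⟩ : ↥(archLocal L 3 (Matrix.diagonal α) w))) x.2.2)))
      ((Measure.pi fun w : {w : {w : InfinitePlace L // IsComplex w} // w ∈ S'} =>
          quotientMeasure (chartTorusGLoc L α w.1 S') (t w.1) (isClosed_chartTorusGLoc L α w.1 S') (ν'w w.1)).prod
        ((quotientMeasure (Subgroup.pi Set.univ (fun w : {w : {w : {w : InfinitePlace L // IsComplex w} // w ∉ S'} // w.1 ∈ E} => chartTorusGLoc L α w.1.1 S')) ρE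
            (isClosed_coe_pi _ fun w => isClosed_chartTorusGLoc L α w.1.1 S')
            (Measure.pi fun w : {w : {w : {w : InfinitePlace L // IsComplex w} // w ∉ S'} // w.1 ∈ E} => ν'w w.1.1)).prod
          (quotientMeasure (Subgroup.pi Set.univ (fun w : {w : {w : {w : InfinitePlace L // IsComplex w} // w ∉ S'} // w.1 ∉ E} => chartTorusGLoc L α w.1.1 S')) ρR
            (isClosed_coe_pi _ fun w => isClosed_chartTorusGLoc L α w.1.1 S')
            (Measure.pi fun w : {w : {w : {w : InfinitePlace L // IsComplex w} // w ∉ S'} // w.1 ∉ E} => ν'w w.1.1)))) := by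
  haveI : ∀ w : {w : InfinitePlace L // IsComplex w}, SecondCountableTopology (↥(archLocal L 3 (Matrix.diagonal α) w) ⧸ chartTorusGLoc L α w S') := fun w => inferInstance
  haveI : ∀ w : {w : InfinitePlace L // IsComplex w},
      SigmaFinite (quotientMeasure (chartTorusGLoc L α w S') (t w) (isClosed_chartTorusGLoc L α w S') (ν'w w)) := fun w => inferInstance
  obtain ⟨Φ, hΦ, hΦx⟩ := exists_measurableEquiv_heldOutFinset L α S' ν'w t E ρE hρE ρR hρR
  rw [← hΦ.integrable_comp_emb Φ.measurableEmbedding]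
  -- in the (A1) §2 coordinates the composite IS the all-places integrand, integrable by ★ (A1) §4
  have hmp := (measurePreserving_piEquivPiSubtypeProd'
    (fun w : {w : InfinitePlace L // IsComplex w} => quotientMeasure (chartTorusGLoc L α w S') (t w) (isClosed_chartTorusGLoc L α w S') (ν'w w))
    (fun w => w ∈ S')).symm
    (MeasurableEquiv.piEquivPiSubtypeProd (fun w : {w : InfinitePlace L // IsComplex w} => ↥(archLocal L 3 (Matrix.diagonal α) w) ⧸ chartTorusGLoc L α w S')
      (fun w => w ∈ S'))
  have hint := (hmp.integrable_comp_emb (MeasurableEquiv.measurableEmbedding _)).2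
    (integrable_comp_symm_archPiEquivCM_descConj_pi_of_regG L α S' ν'w ν' hν t hα hS' hc ha'c ha's)
  refine hint.congr (Filter.Eventually.of_forall fun x => ?_)
  obtain ⟨x₁, x₂⟩ := x
  obtain ⟨h1, h2, h3⟩ := hΦx (x₁, x₂)
  simp only [Function.comp_apply]
  rw [h1, h2, h3, ← heldOutFinset_point_eq L α S' E c x₁ x₂]
  rfl

include hν hρE hρR in
/-- **(A1′)^E ITERATED — `X_E` OUTSIDE** (Fubini on §1 after moving the `E`-factor to the front, ★ `integral_prod_prodLeftComm`; integrability from `integrable_heldOutFinset_of_regG`):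
for admissible `S′`, `c ∈ RegG S′`, `a′ ∈ C_c(G′_∞)`,
`chartOrbG ν′ S′ a′ c = (∏_w t_w(B′_w)) · ∫_{X_E} ( ∫_{(Π_{S′} U⧸T′) × X_R} a′ (e⁻¹ (…)) d((⊗_{S′} q_w) ⊗ Q_R) ) dQ_E(x_E)` — the orbital integral over the held-out product group of
a function of `g γ_E(c) g⁻¹ ∈ Π_{ιE} U_w` (what L1^m descends). [cite: Rogawski1990, §8.2 p. 122; §8.3 pp. 122–124] [cite: Folland1995, §2.6 (2.52)] [cite: DeitmarEchterhoff2014, Lemma 9.3.3] -/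
theorem chartOrbG_eq_prod_mul_integral_integral_heldOutFinset_of_regG (hα : ∀ i, α i ≠ 0) (hS' : ∀ w, w ∈ S' → w ∈ splitChartPlaces L α)
    {c : {w : InfinitePlace L // IsComplex w} → Fin 3 → ℝ} (hc : c ∈ RegG S')
    {a' : ↥(arch (↥(maximalRealSubfield L)) L (IsCMField.complexConj L) 3 (Matrix.diagonal α)) → ℂ} (ha'c : Continuous a') (ha's : HasCompactSupport a') :
    chartOrbG L α ν' S' a' c =
      (∏ w, ((t w (chartBoxImgGLoc L α w S')).toReal : ℂ)) *
        ∫ xE : ((∀ w : {w : {w : {w : InfinitePlace L // IsComplex w} // w ∉ S'} // w.1 ∈ E}, ↥(archLocal L 3 (Matrix.diagonal α) w.1.1)) ⧸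
            Subgroup.pi Set.univ (fun w : {w : {w : {w : InfinitePlace L // IsComplex w} // w ∉ S'} // w.1 ∈ E} => chartTorusGLoc L α w.1.1 S')),
          (∫ p : (∀ w : {w : {w : InfinitePlace L // IsComplex w} // w ∈ S'}, ↥(archLocal L 3 (Matrix.diagonal α) w.1) ⧸ chartTorusGLoc L α w.1 S') ×
              ((∀ w : {w : {w : {w : InfinitePlace L // IsComplex w} // w ∉ S'} // w.1 ∉ E}, ↥(archLocal L 3 (Matrix.diagonal α) w.1.1)) ⧸
            Subgroup.pi Set.univ (fun w : {w : {w : {w : InfinitePlace L // IsComplex w} // w ∉ S'} // w.1 ∉ E} => chartTorusGLoc L α w.1.1 S')),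
            a' ((archPiEquivCM 3 L (Matrix.diagonal α)).symm (fun w =>
            if h : w ∈ S' then
              descConj (gprimeBlockAt L α w S' (c w)) (chartTorusGLoc L α w S') (forall_mem_chartTorusGLoc_comm L α w S' (c w)) id (p.1 ⟨w, h⟩)
            else if hE : w ∈ E then
              descConj (fun w : {w : {w : {w : InfinitePlace L // IsComplex w} // w ∉ S'} // w.1 ∈ E} => gprimeBlock L α w.1.1 S' c)
                (Subgroup.pi Set.univ (fun w : {w : {w : {w : InfinitePlace L // IsComplex w} // w ∉ S'} // w.1 ∈ E} => chartTorusGLoc L α w.1.1 S'))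
                (forall_mem_pi_chartTorusGLoc_comm L α S' (fun w : {w : {w : {w : InfinitePlace L // IsComplex w} // w ∉ S'} // w.1 ∈ E} => w.1.1) c)
                (fun g => (g ⟨⟨w, h⟩, hE⟩ : ↥(archLocal L 3 (Matrix.diagonal α) w))) xE
            else
              descConj (fun w : {w : {w : {w : InfinitePlace L // IsComplex w} // w ∉ S'} // w.1 ∉ E} => gprimeBlock L α w.1.1 S' c)
                (Subgroup.pi Set.univ (fun w : {w : {w : {w : InfinitePlace L // IsComplex w} // w ∉ S'} // w.1 ∉ E} => chartTorusGLoc L α w.1.1 S'))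
                (forall_mem_pi_chartTorusGLoc_comm L α S' (fun w : {w : {w : {w : InfinitePlace L // IsComplex w} // w ∉ S'} // w.1 ∉ E} => w.1.1) c)
                (fun g => (g ⟨⟨w, h⟩, hE⟩ : ↥(archLocal L 3 (Matrix.diagonal α) w))) p.2))
            ∂((Measure.pi fun w : {w : {w : InfinitePlace L // IsComplex w} // w ∈ S'} =>
                quotientMeasure (chartTorusGLoc L α w.1 S') (t w.1) (isClosed_chartTorusGLoc L α w.1 S') (ν'w w.1)).prod
              (quotientMeasure (Subgroup.pi Set.univ (fun w : {w : {w : {w : InfinitePlace L // IsComplex w} // w ∉ S'} // w.1 ∉ E} => chartTorusGLoc L α w.1.1 S')) ρR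
            (isClosed_coe_pi _ fun w => isClosed_chartTorusGLoc L α w.1.1 S')
            (Measure.pi fun w : {w : {w : {w : InfinitePlace L // IsComplex w} // w ∉ S'} // w.1 ∉ E} => ν'w w.1.1))))
          ∂(quotientMeasure (Subgroup.pi Set.univ (fun w : {w : {w : {w : InfinitePlace L // IsComplex w} // w ∉ S'} // w.1 ∈ E} => chartTorusGLoc L α w.1.1 S')) ρE
            (isClosed_coe_pi _ fun w => isClosed_chartTorusGLoc L α w.1.1 S')
            (Measure.pi fun w : {w : {w : {w : InfinitePlace L // IsComplex w} // w ∉ S'} // w.1 ∈ E} => ν'w w.1.1)) := by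
  haveI : ∀ w : {w : InfinitePlace L // IsComplex w}, SecondCountableTopology (↥(archLocal L 3 (Matrix.diagonal α) w) ⧸ chartTorusGLoc L α w S') := fun w => inferInstance
  haveI : ∀ w : {w : InfinitePlace L // IsComplex w},
      SigmaFinite (quotientMeasure (chartTorusGLoc L α w S') (t w) (isClosed_chartTorusGLoc L α w S') (ν'w w)) := fun w => inferInstance
  have hMcE : IsClosed ((Subgroup.pi Set.univ (fun w : {w : {w : {w : InfinitePlace L // IsComplex w} // w ∉ S'} // w.1 ∈ E} => chartTorusGLoc L α w.1.1 S')) :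
      Set (∀ w : {w : {w : {w : InfinitePlace L // IsComplex w} // w ∉ S'} // w.1 ∈ E}, ↥(archLocal L 3 (Matrix.diagonal α) w.1.1))) :=
    isClosed_coe_pi _ fun w => isClosed_chartTorusGLoc L α w.1.1 S'
  haveI : LocallyCompactSpace ↥(Subgroup.pi Set.univ (fun w : {w : {w : {w : InfinitePlace L // IsComplex w} // w ∉ S'} // w.1 ∈ E} => chartTorusGLoc L α w.1.1 S')) :=
    hMcE.isClosedEmbedding_subtypeVal.locallyCompactSpace
  haveI : SecondCountableTopology ↥(Subgroup.pi Set.univ (fun w : {w : {w : {w : InfinitePlace L // IsComplex w} // w ∉ S'} // w.1 ∈ E} => chartTorusGLoc L α w.1.1 S')) :=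
    TopologicalSpace.Subtype.secondCountableTopology _
  haveI : SFinite ρE := inferInstance
  have hMcR : IsClosed ((Subgroup.pi Set.univ (fun w : {w : {w : {w : InfinitePlace L // IsComplex w} // w ∉ S'} // w.1 ∉ E} => chartTorusGLoc L α w.1.1 S')) :
      Set (∀ w : {w : {w : {w : InfinitePlace L // IsComplex w} // w ∉ S'} // w.1 ∉ E}, ↥(archLocal L 3 (Matrix.diagonal α) w.1.1))) :=
    isClosed_coe_pi _ fun w => isClosed_chartTorusGLoc L α w.1.1 S'
  haveI : LocallyCompactSpace ↥(Subgroup.pi Set.univ (fun w : {w : {w : {w : InfinitePlace L // IsComplex w} // w ∉ S'} // w.1 ∉ E} => chartTorusGLoc L α w.1.1 S')) :=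
    hMcR.isClosedEmbedding_subtypeVal.locallyCompactSpace
  haveI : SecondCountableTopology ↥(Subgroup.pi Set.univ (fun w : {w : {w : {w : InfinitePlace L // IsComplex w} // w ∉ S'} // w.1 ∉ E} => chartTorusGLoc L α w.1.1 S')) :=
    TopologicalSpace.Subtype.secondCountableTopology _
  haveI : SFinite ρR := inferInstance
  rw [chartOrbG_eq_prod_mul_integral_pi_prod_heldOutFinset L α S' ν'w ν' hν t E ρE hρE ρR hρR hα hS' a' c, integral_prod_prodLeftComm]
  congr 1
  rw [integral_prod _ ((integrable_prodLeftComm_iff _ _ _ _).2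
    (integrable_heldOutFinset_of_regG L α S' ν'w ν' hν t E ρE hρE ρR hρR hα hS' hc ha'c ha's))]

end HeldOutFinset
end Literature.NumberTheory.Automorphic.UnitaryGroup
end
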